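import Literature.NumberTheory.Rogawski1990.KottwitzSteinbergUnitaryCM
import Literature.NumberTheory.QuadraticForms.LandherrHermitianMatrices
import Literature.NumberTheory.QuadraticForms.LandherrHermitianRealisation
import HarnessLib

/-!
# The Landherr step of Kottwitz–Steinberg for `U(3)` over a CM field: a non-degenerate hermitian `3 × 3` matrix with BALANCED
# signature at every real place is congruent to a scalar multiple of the split form `Φ₃` (Rogawski 1990, Thm. 3.2.1 ∕ §1.9; Landherr)

Topic `NumberTheory/Rogawski1990`; namespace `Literature.NumberTheory.Rogawski1990`; THEOREMS ONLY (no def, no named fact, no instance, no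
notation), on top of ★ Landherr's theorem `Literature.NumberTheory.QuadraticForms.hermitianMatrices_congruent_iff_invariants` and ★
`StableConjugacyU3`.  This is step K3 of the Kottwitz–Steinberg programme of ★ `KottwitzSteinbergUnitaryCM`: it SHRINKS the residual
`AdjustedFormCongruent` («the `γ′`-adjusted form `H′X` is congruent to `a • Φ₃`») to «`H′X` has balanced signatures», because:

**`exists_congr_smul_antidiagThree_of_balanced`**: for a CM field `L` (conjugation `c`), a `c`-hermitian `M ∈ M₃(L)` with `det M ≠ 0`
whose complex images `τ(M)` have `1` or `2` positive eigenvalues at EVERY embedding `τ : L → ℂ` (signature `(2,1)` or `(1,2)` at every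
real place of `L⁺`), there are `g ∈ GL₃(L)` and `a ∈ (L⁺)^×` with `ᵗ(c g) · M · g = a • Φ₃`, `Φ₃ = antidiag(1,1,1)`.
PROOF: `a := −det M ∈ L⁺`; `Φ₃ ≅ diag(2, 1, −2)` by an explicit rational congruence (`conjTranspose_baseChange_mul_antidiagThree_mul`), so
`a • Φ₃` has `2` (resp. `1`) positive eigenvalues at `τ` iff `τ(a) > 0` (resp. `< 0`) (★ Sylvester `card_pos_eigenvalues_eq_posCount`);
`τ(a) = −τ(det M) = −∏ eigenvalues(τM)` is positive iff `τ(M)` has exactly one negative eigenvalue iff (balanced!) two positive ones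
(★ `Landherr.prod_pos_iff_even_card_neg`); and `det M = det(a • Φ₃) · N(a⁻¹)` since `det(a • Φ₃) = −a³` — so Landherr's invariants agree.

[Rogawski1990, §3.2 Thm. 3.2.1 p. 19 (Kottwitz–Steinberg); §1.9 (`U(Φ_n)` quasi-split, `n` odd)]; [Landherr1936HermitianForms] through the tree.
-/

noncomputable section

namespace Literature.NumberTheory.Rogawski1990

open scoped MatrixGroups
open NumberField Matrix Finset
open Literature.NumberTheory.QuadraticForms
open Literature.NumberTheory.QuadraticForms.Landherr (conjTranspose conjTranspose_apply isHermitian_map posCount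
  card_pos_eigenvalues_eq_posCount prod_pos_iff_even_card_neg)

variable (L : Type) [Field L] [NumberField L] [IsCMField L]

/-! ## §1 The split form `Φ₃ = antidiag(1,1,1)` and its diagonalisation `diag(2, 1, −2)` -/

omit [NumberField L] [IsCMField L] in
/-- `Φ₃ = antidiag(1,1,1)` — the line's `splitForm L 3`, inlined. [cite: Rogawski1990, §1.9] -/
theorem antidiagThree_eq : (Matrix.of fun i j : Fin 3 => if i.val + j.val + 1 = 3 then (1 : L) else 0) = !![0, 0, 1; 0, 1, 0; 1, 0, 0] := by
  ext i j; fin_cases i <;> fin_cases j <;> rfl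

omit [NumberField L] [IsCMField L] in
/-- `det Φ₃ = −1`. [cite: Rogawski1990, §1.9] -/
theorem det_antidiagThree : (!![0, 0, 1; 0, 1, 0; 1, 0, 0] : Matrix (Fin 3) (Fin 3) L).det = -1 := by
  rw [Matrix.det_fin_three]; simp

/-- `Φ₃` is `c`-hermitian. [cite: Rogawski1990, §1.9] -/
theorem conjTranspose_antidiagThree : conjTranspose L (!![0, 0, 1; 0, 1, 0; 1, 0, 0] : Matrix (Fin 3) (Fin 3) L) = !![0, 0, 1; 0, 1, 0; 1, 0, 0] := by
  ext i j; fin_cases i <;> fin_cases j <;> simp [conjTranspose_apply]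

/-- `a • Φ₃` is `c`-hermitian for `a ∈ L⁺`. [cite: Rogawski1990, §1.9] -/
theorem conjTranspose_smul_antidiagThree {a : L} (ha : IsCMField.complexConj L a = a) :
    conjTranspose L (a • (!![0, 0, 1; 0, 1, 0; 1, 0, 0] : Matrix (Fin 3) (Fin 3) L)) = a • !![0, 0, 1; 0, 1, 0; 1, 0, 0] := by
  ext i j; fin_cases i <;> fin_cases j <;> simp [conjTranspose_apply, ha]

/-- The rational base change `G₀ = (e₁+e₃ | e₂ | e₁−e₃)` diagonalising `Φ₃`: `ᵗ(cG₀) (a•Φ₃) G₀ = diag(2a, a, −2a)`. [cite: Rogawski1990, §1.9] -/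
theorem conjTranspose_baseChange_mul_antidiagThree_mul (a : L) :
    conjTranspose L (!![1, 0, 1; 0, 1, 0; 1, 0, -1] : Matrix (Fin 3) (Fin 3) L) * (a • !![0, 0, 1; 0, 1, 0; 1, 0, 0]) *
        !![1, 0, 1; 0, 1, 0; 1, 0, -1] = Matrix.diagonal ![2 * a, a, -(2 * a)] := by
  have hc : conjTranspose L (!![1, 0, 1; 0, 1, 0; 1, 0, -1] : Matrix (Fin 3) (Fin 3) L) = !![1, 0, 1; 0, 1, 0; 1, 0, -1] := by
    ext i j; fin_cases i <;> fin_cases j <;> simp [conjTranspose_apply]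
  rw [hc]
  ext i j; fin_cases i <;> fin_cases j <;> simp [Matrix.mul_apply, Fin.sum_univ_three] <;> ring

omit [IsCMField L] in
/-- `det G₀ = −2 ≠ 0` (characteristic `0`). [cite: Rogawski1990, §1.9] -/
theorem isUnit_det_baseChange : IsUnit (!![1, 0, 1; 0, 1, 0; 1, 0, -1] : Matrix (Fin 3) (Fin 3) L).det := by
  rw [isUnit_iff_ne_zero, Matrix.det_fin_three]
  simp
  norm_num

/-! ## §2 Real elements of `L` under complex embeddings; the signature of `a • Φ₃` -/

/-- A `c`-fixed element of the CM field `L` has REAL image under every complex embedding. [cite: Rogawski1990, §1.9] -/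
theorem im_embedding_eq_zero_of_conj_eq {a : L} (ha : IsCMField.complexConj L a = a) (τ : L →+* ℂ) : (τ a).im = 0 := by
  have h := IsCMField.complexEmbedding_complexConj L τ a
  rw [ha] at h
  -- `τ a = conj (τ a)`
  exact Complex.conj_eq_iff_im.mp h.symm

/-- The positive index of `diag(2a, a, −2a)` at `τ`: `2` if `τ(a) > 0`, `1` if `τ(a) < 0`. [cite: Rogawski1990, §1.9] -/
theorem posCount_diag_antidiagThree {a : L} (ha : IsCMField.complexConj L a = a) (ha0 : a ≠ 0) (τ : L →+* ℂ) :
    posCount L τ ![2 * a, a, -(2 * a)] = if 0 < (τ a).re then 2 else 1 := by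
  have hre : (τ a).re ≠ 0 := by
    intro h
    apply ha0
    apply τ.injective
    rw [map_zero]
    exact Complex.ext h (im_embedding_eq_zero_of_conj_eq L ha τ)
  simp only [posCount]
  rw [Finset.card_filter, Fin.sum_univ_three]
  simp only [Matrix.cons_val_zero, Matrix.cons_val_one, Matrix.cons_val_two, Matrix.head_cons, Matrix.tail_cons, map_mul, map_neg,
    map_ofNat, Complex.mul_re, Complex.neg_re, Complex.re_ofNat, Complex.im_ofNat, zero_mul, sub_zero]
  rcases lt_or_gt_of_ne hre with h | h
  · rw [if_neg (by linarith), if_neg (not_lt.mpr h.le), if_pos (by linarith), if_neg (not_lt.mpr h.le)]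
  · rw [if_pos (by linarith), if_pos h, if_neg (by linarith), if_pos h]

/-! ## §3 The balanced case: signatures via the determinant -/

/-- For a `c`-hermitian `3 × 3` matrix `M` with `det M ≠ 0` and `1` or `2` positive eigenvalues at `τ`: there are `2` positive eigenvalues
iff `τ(det M) < 0` (one negative eigenvalue). [cite: Rogawski1990, §3.2 Thm. 3.2.1 p. 19] -/
theorem card_pos_eigenvalues_eq_two_iff {M : Matrix (Fin 3) (Fin 3) L} (hM : conjTranspose L M = M) (h0 : M.det ≠ 0) (τ : L →+* ℂ)
    (hbal : (univ.filter fun i => 0 < (isHermitian_map L hM τ).eigenvalues i).card = 1 ∨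
      (univ.filter fun i => 0 < (isHermitian_map L hM τ).eigenvalues i).card = 2) :
    (univ.filter fun i => 0 < (isHermitian_map L hM τ).eigenvalues i).card = 2 ↔ (τ M.det).re < 0 := by
  set e := (isHermitian_map L hM τ).eigenvalues with he
  -- `τ(det M) = ∏ eigenvalues` (real)
  have hdet : τ M.det = ∏ i, (e i : ℂ) := by
    rw [RingHom.map_det, RingHom.mapMatrix_apply]
    exact (isHermitian_map L hM τ).det_eq_prod_eigenvalues
  have hdet_re : (τ M.det).re = ∏ i, e i := by
    rw [hdet, ← Complex.ofReal_prod, Complex.ofReal_re]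
  have he0 : ∀ i ∈ (univ : Finset (Fin 3)), e i ≠ 0 := by
    intro i _ hi
    apply (map_ne_zero τ).mpr h0
    rw [hdet]
    exact Finset.prod_eq_zero (Finset.mem_univ i) (by rw [hi, Complex.ofReal_zero])
  -- positives + negatives = 3
  have hsum : (univ.filter fun i => 0 < e i).card + (univ.filter fun i => e i < 0).card = 3 := by
    have h := Finset.card_filter_add_card_filter_not (s := (univ : Finset (Fin 3))) (fun i => 0 < e i)
    have h2 : (univ.filter fun i => ¬ 0 < e i) = univ.filter fun i => e i < 0 := by
      refine Finset.filter_congr fun i hi => ?_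
      rcases lt_or_gt_of_ne (he0 i hi) with h' | h'
      · exact ⟨fun _ => h', fun _ => not_lt.mpr h'.le⟩
      · exact ⟨fun hn => absurd h' hn, fun hn => absurd h' (not_lt.mpr hn.le)⟩
    rw [h2, Finset.card_univ, Fintype.card_fin] at h
    exact h
  have hprod : 0 < ∏ i, e i ↔ Even (univ.filter fun i => e i < 0).card := prod_pos_iff_even_card_neg univ e he0
  have hprod0 : ∏ i, e i ≠ 0 := Finset.prod_ne_zero_iff.mpr he0
  rw [hdet_re]
  rcases hbal with h1 | h2
  · -- one positive, two negative: product positive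
    rw [h1] at hsum ⊢
    have hneg : (univ.filter fun i => e i < 0).card = 2 := by omega
    have hpos : 0 < ∏ i, e i := hprod.mpr (by rw [hneg]; exact even_two)
    constructor
    · intro h; exact absurd h (by decide)
    · intro h; exact absurd hpos (not_lt.mpr h.le)
  · rw [h2] at hsum ⊢
    have hneg : (univ.filter fun i => e i < 0).card = 1 := by omega
    have hnpos : ¬ 0 < ∏ i, e i := fun h => by
      have := hprod.mp h; rw [hneg] at this; exact Nat.not_even_one this
    exact ⟨fun _ => lt_of_le_of_ne (not_lt.mp hnpos) hprod0, fun _ => rfl⟩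

/-! ## §4 The Landherr step -/

/-- The determinant of a `c`-hermitian matrix is `c`-fixed (lies in `L⁺`). [cite: Rogawski1990, §1.9] -/
theorem conj_det_eq_of_conjTranspose_eq {ι : Type} [Fintype ι] [DecidableEq ι] {M : Matrix ι ι L} (hM : conjTranspose L M = M) :
    IsCMField.complexConj L M.det = M.det := by
  have h : (conjTranspose L M).det = IsCMField.complexConj L M.det := by
    rw [Landherr.conjTranspose, ← Matrix.det_transpose M]
    change ((IsCMField.complexConj L : L →+* L).mapMatrix M.transpose).det = _
    rw [← RingHom.map_det]
    rfl
  rw [← h, hM]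

/-- **The Landherr step (`n = 3`)**: a non-degenerate `c`-hermitian `M ∈ M₃(L)` with `1` or `2` positive eigenvalues at every complex
embedding is congruent over `L` to `a • Φ₃` with `a = −det M ∈ (L⁺)^×`: `ᵗ(c g) · M · g = a • Φ₃` for some `g ∈ GL₃(L)`.
[cite: Rogawski1990, §3.2 Thm. 3.2.1 p. 19] -/
theorem exists_congr_smul_antidiagThree_of_balanced (M : Matrix (Fin 3) (Fin 3) L) (hM : conjTranspose L M = M) (h0 : M.det ≠ 0)
    (hbal : ∀ τ : L →+* ℂ, (univ.filter fun i => 0 < (isHermitian_map L hM τ).eigenvalues i).card = 1 ∨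
      (univ.filter fun i => 0 < (isHermitian_map L hM τ).eigenvalues i).card = 2) :
    ∃ (g : GL (Fin 3) L) (a : L), a ≠ 0 ∧ IsCMField.complexConj L a = a ∧
      conjTranspose L (g : Matrix (Fin 3) (Fin 3) L) * M * (g : Matrix (Fin 3) (Fin 3) L) = a • !![0, 0, 1; 0, 1, 0; 1, 0, 0] := by
  set a : L := -M.det with ha_def
  have ha0 : a ≠ 0 := neg_ne_zero.mpr h0
  have hac : IsCMField.complexConj L a = a := by rw [ha_def, map_neg, conj_det_eq_of_conjTranspose_eq L hM]
  have hΦ : conjTranspose L (a • (!![0, 0, 1; 0, 1, 0; 1, 0, 0] : Matrix (Fin 3) (Fin 3) L)) = a • !![0, 0, 1; 0, 1, 0; 1, 0, 0] :=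
    conjTranspose_smul_antidiagThree L hac
  have hdetΦ : (a • (!![0, 0, 1; 0, 1, 0; 1, 0, 0] : Matrix (Fin 3) (Fin 3) L)).det = -(a ^ 3) := by
    rw [Matrix.det_smul, det_antidiagThree, Fintype.card_fin]; ring
  have hΦ0 : (a • (!![0, 0, 1; 0, 1, 0; 1, 0, 0] : Matrix (Fin 3) (Fin 3) L)).det ≠ 0 := by
    rw [hdetΦ]; exact neg_ne_zero.mpr (pow_ne_zero 3 ha0)
  refine (hermitianMatrices_congruent_iff_invariants_fin L 3 M (a • !![0, 0, 1; 0, 1, 0; 1, 0, 0]) hM hΦ h0 hΦ0).mpr ⟨fun τ => ?_, ?_⟩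
    |>.imp fun g hg => ⟨a, ha0, hac, hg⟩
  · -- signatures: both sides are `2` iff `τ(a) > 0`
    rw [card_pos_eigenvalues_eq_posCount L hΦ (isUnit_det_baseChange L) (conjTranspose_baseChange_mul_antidiagThree_mul L a) τ,
      posCount_diag_antidiagThree L hac ha0 τ]
    have hτa : (τ a).re = -(τ M.det).re := by rw [ha_def, map_neg, Complex.neg_re]
    by_cases hpos : 0 < (τ a).re
    · rw [if_pos hpos]
      exact (card_pos_eigenvalues_eq_two_iff L hM h0 τ (hbal τ)).mpr (by linarith)
    · rw [if_neg hpos]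
      rcases hbal τ with h1 | h2
      · exact h1
      · exfalso; apply hpos; rw [hτa]
        have := (card_pos_eigenvalues_eq_two_iff L hM h0 τ (hbal τ)).mp h2
        linarith
  · -- discriminants: `det M = det(a•Φ₃) · N(a⁻¹)`
    refine ⟨a⁻¹, inv_ne_zero ha0, ?_⟩
    rw [hdetΦ, map_inv₀, hac, ha_def]
    field_simp

/-! ## §5 The residual of ★ `KottwitzSteinbergUnitaryCM` shrunk to «balanced signature adjustment in the commutant» (`n = 3`) -/

open Literature.AlgebraicGeometry.ShimuraVarieties (unitaryGroup) in
open Literature.NumberTheory.Automorphic (cmConjRingHom) in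
/-- **`AdjustedFormCongruent (cmConjRingHom L) H′ Φ₃` from BALANCED ADJUSTMENT**: if for every semisimple `γ′ ∈ U(H′)(L⁺)` the commutant
of `γ′` contains an invertible `X` making `H′X` a non-degenerate `c`-hermitian form with `1` or `2` positive eigenvalues at every complex
embedding, then the residual named statement of ★ `KottwitzSteinbergUnitaryCM` holds for `(U(H′), U(Φ₃))` — by the Landherr step
`exists_congr_smul_antidiagThree_of_balanced`.  What is left of Kottwitz–Steinberg (Thm. 3.2.1) for `U(3)` over a CM field is thus
exactly this signature adjustment (weak approximation in the self-adjoint part of the commutant). [cite: Rogawski1990, §3.2 Thm. 3.2.1 p. 19] -/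
theorem adjustedFormCongruent_antidiagThree_of_balanced (H' : Matrix (Fin 3) (Fin 3) L)
    (h : ∀ γ' : unitaryGroup (cmConjRingHom L) H', IsSemisimpleElt (cmConjRingHom L) H' γ' →
      ∃ (X : GL (Fin 3) L) (hX : conjTranspose L (H' * (X : Matrix (Fin 3) (Fin 3) L)) = H' * (X : Matrix (Fin 3) (Fin 3) L)),
        Commute ((γ' : GL (Fin 3) L) : Matrix (Fin 3) (Fin 3) L) (X : Matrix (Fin 3) (Fin 3) L) ∧
        (H' * (X : Matrix (Fin 3) (Fin 3) L)).det ≠ 0 ∧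
        ∀ τ : L →+* ℂ, (univ.filter fun i => 0 < (isHermitian_map L hX τ).eigenvalues i).card = 1 ∨
          (univ.filter fun i => 0 < (isHermitian_map L hX τ).eigenvalues i).card = 2) :
    AdjustedFormCongruent (cmConjRingHom L) H' (Matrix.of fun i j : Fin 3 => if i.val + j.val + 1 = 3 then (1 : L) else 0) := by
  intro γ' hss
  obtain ⟨X, hX, hcomm, h0, hbal⟩ := h γ' hss
  obtain ⟨g, a, ha0, -, hg⟩ := exists_congr_smul_antidiagThree_of_balanced L (H' * (X : Matrix (Fin 3) (Fin 3) L)) hX h0 hbal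
  refine ⟨X, g, a, isUnit_iff_ne_zero.mpr ha0, hcomm, ?_⟩
  rw [antidiagThree_eq, ← hg, Landherr.conjTranspose, Matrix.transpose_map]
  rfl

end Literature.NumberTheory.Rogawski1990
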